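import Literature.NumberTheory.Sieve.ParityWave0GreenTaoHolds
import Literature.Combinatorics.Additive.SzemerediVarnavides

/-!
# Szemerédi's theorem, slice by slice: `SzemerediFinitary k` and `SzemerediWeighted k` hold for every `k`

E. Szemerédi, *On sets of integers containing no `k` elements in arithmetic progression*, Acta Arith.
27 (1975), Main Theorem, in the finitary form of Polymath 2012 Thm. 1.2 (`SzemerediFinitary k`) and in
the weighted/expectation form of Conlon–Fox–Zhao 2014 Thm. 4.1 (`SzemerediWeighted k`).  The tree
proves the bundled named fact `SzemerediTheorem` (`SzemerediTheorem_holds`, file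
`NumberTheory/Sieve/ParityWave0GreenTaoHolds.lean`, via the density Hales–Jewett theorem) and the
slicing implications `szemerediFinitary_of_szemerediTheorem`, `szemerediWeighted_of_szemerediTheorem`
(`SzemerediVarnavides.lean`, which cannot import the Hales–Jewett files); this leaf records the two
compositions, so that the PARAMETRIC named facts `SzemerediFinitary` and `SzemerediWeighted` carry
their `_holds` (D-0026 bookkeeping: proof terms are existing theorems of the tree composed; no
statement, definition or attribute is edited; no new named fact).

## References

* E. Szemerédi, Acta Arith. 27 (1975), 199–245, Main Theorem. [Szemeredi1975]
* D. Conlon, J. Fox, Y. Zhao, *A relative Szemerédi theorem*, GAFA 25 (2015), Thm. 4.1. [ConlonFoxZhao2014]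
-/

namespace Literature.Combinatorics.Additive

/-- **Szemerédi's theorem, finitary form at length `k`** (every `k`; `r_k(N) = o(N)` in the form of
Polymath 2012 Thm. 1.2), unconditionally: the bundled `SzemerediTheorem_holds` sliced by
`szemerediFinitary_of_szemerediTheorem`. [cite: Szemeredi1975, Main Theorem] -/
theorem SzemerediFinitary_holds (k : ℕ) : Literature.Combinatorics.Additive.SzemerediFinitary k :=
  szemerediFinitary_of_szemerediTheorem SzemerediTheorem_holds k

/-- **Szemerédi's theorem, weighted form at length `k`** (every `k`; Varnavides and the passage to
weights), unconditionally: `szemerediWeighted_of_szemerediTheorem` applied to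
`SzemerediTheorem_holds`. [cite: ConlonFoxZhao2014, Theorem 4.1] -/
theorem SzemerediWeighted_holds (k : ℕ) : Literature.Combinatorics.Additive.SzemerediWeighted k :=
  szemerediWeighted_of_szemerediTheorem SzemerediTheorem_holds k

end Literature.Combinatorics.Additive
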